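import Summits.Ventures.CertifiedQuantumChemistry.Rows.OrbitalRotationCovariance
import Literature.MathematicalPhysics.QuantumChemistry.SlaterDeterminantRDMs
import HarnessLib

/-!
# Ventures/CertifiedQuantumChemistry — Rows/OrbitalRotationHamiltonian.lean: the Bogoliubov lift
# `Γ(Ū)` conjugates the model Hamiltonian `Ĥ(h, g)` into `Ĥ(h', g')` (rotated integral tables)

HONEST FRAMING (verbatim): certified bounds for a stated model Hamiltonian in a stated basis; not a
claim about the real molecule beyond that model.

Seat rdm-B, ROWS courtesy file (theorems only; no `def`, no notation); the EXACT-SIDE companion of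
the orbital-rotation set (`Rows/OrbitalRotationCovariance.lean`, `…Energy.lean`, `…Invariance.lean`),
which proves covariance of the relaxations; its consequences for the exact energies are in
`Rows/OrbitalRotationExactInvariance.lean`. Data as in the companion files: a one-particle matrix
`u : Matrix Λ Λ ℂ`, a spin-free lift `U` (`hUu : U_{pσ,qτ} = δ_{στ} u_{pq}`) with `U U† = 1`, and the
ROTATED INTEGRAL TABLES `h'_{ab} = Σ_{pq} u_{pa} ū_{qb} h_{pq}`,
`g'_{abcd} = Σ_{pqrs} u_{pa} ū_{qb} u_{rc} ū_{sd} g_{pqrs}` of `rdmEnergy_conj_orbital`. The implementer on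
the Fock space is the second quantisation `Γ(Ū)` of the entrywise conjugate `Ū = U.map star` (tree
`QuantumLattice.FermionGammaFunctor`): the unitary taking the Slater determinant of orbitals `e_m`,
`m ∈ S`, to the determinant of the rotated orbitals `Σ_i U_{im} e_i`.

* §1 `oneRDM_Gamma_mapStar_mulVec`, `twoRDM_Gamma_mapStar_mulVec` (any spin-orbital set `ι`, any
  unitary `U`): THE RDM PAIR OF THE ROTATED STATE IS THE ROTATED PAIR of the covariance files,
  `¹D(Γ(Ū)ψ) = U ¹D(ψ) U†`, `²D(Γ(Ū)ψ) = (U⊗U) ²D(ψ) (U⊗U)†` (Bratteli–Robinson II §5.2.1, via the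
  tree's `oneRDM_Gamma_mulVec` / `twoRDM_Gamma_mulVec`);
* §2 `create_orbital`, `annihilate_orbital`, `conjTranspose_Gamma_mul_singletExcitation_mul_Gamma`,
  `conjTranspose_Gamma_mul_twoElectronExcitation_mul_Gamma`: `Γ(Ū)† E_pq Γ(Ū) = Σ_{ab} u_{pa} ū_{qb} E_ab`,
  `Γ(Ū)† e_pqrs Γ(Ū) = Σ_{abcd} u_{pa} ū_{qb} u_{rc} ū_{sd} e_abcd` — the excitation operators transform
  contragrediently to the integrals (Helgaker–Jørgensen–Olsen §3.2: orbital rotations `exp(−κ̂)` act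
  on the `E_pq` through the MO coefficients); `sum_smul_mul_sum_smul_mul_mul`, `sum_smul_sum_smul_comm`
  are the pure-algebra expansions / Fubini steps;
* §3 **`conjTranspose_Gamma_mul_molecularHamiltonian_mul_Gamma`** — THE OPERATOR IDENTITY
  `Γ(Ū)† Ĥ(h, g, h_nuc) Γ(Ū) = Ĥ(h', g', h_nuc)` (and `…_prod`, the same with bundled orbital sums).

READING: statements about the ABSTRACT model Hamiltonian; no certificate sentence, no row / hint /
claim node depends on them. Everything is PROVED (0 sorry, standard axioms); no definitions, no
named facts.

References: T. Helgaker, P. Jørgensen, J. Olsen, *Molecular Electronic-Structure Theory* (Wiley 2000)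
§3.2 (unitary orbital transformations, eqs. (3.2.11)–(3.2.17)); O. Bratteli, D. W. Robinson, *Operator
Algebras and Quantum Statistical Mechanics 2* (Springer 1997) §5.2.1 (`Γ(U) a*(f) Γ(U)* = a*(Uf)`);
D. A. Mazziotti, in *Reduced-Density-Matrix Mechanics*, Adv. Chem. Phys. 134 (Wiley 2007) ch. 3 §II.A
eqs. (4)–(7).

Tree (REUSED): `Gamma`, `Gamma_mem_unitaryGroup` (`QuantumLattice.FermionGammaFunctor`);
`conjTranspose_Gamma_mul_excitation_mul_Gamma`, `oneRDM_Gamma_mulVec` (`ColemanOneMatrixRepresentability`);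
`conjTranspose_Gamma_mul_twoString_mul_Gamma`, `twoRDM_Gamma_mulVec` (`SlaterDeterminantRDMs`);
`singletExcitation`, `twoElectronExcitation`, `molecularHamiltonian` (`SecondQuantizedHamiltonian`);
`mul_mul_apply` (`Rows/OrbitalRotationCovariance`); `sum_orb_eq_sum_sum`
(`QuantumLattice.FreeFermionSpinTwistedTraceFormula`). Mathlib: `Matrix.map_star_mem_unitaryGroup_iff`,
`Fintype.sum_prod_type`, `Finset.sum_comm`, `Finset.sum_mul_sum`.
-/

noncomputable section

namespace Summit.Ventures.CertifiedQuantumChemistry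

open Matrix Finset
open Literature.MathematicalPhysics.QuantumLattice Literature.MathematicalPhysics.QuantumLattice.RayleighBound
  Literature.MathematicalPhysics.QuantumChemistry
open scoped ComplexOrder Kronecker

/-! ## §0 Bookkeeping: the entrywise conjugate of a unitary; a Fubini rearrangement with scalars -/

section Bookkeeping

variable {ι : Type*} [Fintype ι] [DecidableEq ι]

/-- `U U† = 1` puts `U` in Mathlib's unitary group. -/
theorem mem_unitaryGroup_of_mul_conjTranspose {U : Matrix ι ι ℂ} (hU : U * Uᴴ = 1) :
    U ∈ Matrix.unitaryGroup ι ℂ := by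
  rw [Matrix.mem_unitaryGroup_iff, star_eq_conjTranspose, hU]

/-- The entrywise conjugate `Ū = U.map star` of a unitary is unitary. -/
theorem mapStar_mem_unitaryGroup {U : Matrix ι ι ℂ} (hU : U * Uᴴ = 1) :
    U.map star ∈ Matrix.unitaryGroup ι ℂ :=
  Matrix.map_star_mem_unitaryGroup_iff.mpr (mem_unitaryGroup_of_mul_conjTranspose hU)

/-- `Γ(V)† Γ(V) = 1` for unitary `V`. -/
theorem conjTranspose_Gamma_mul_Gamma {ι : Type*} [LinearOrder ι] [Fintype ι] {V : Matrix ι ι ℂ}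
    (hV : V ∈ Matrix.unitaryGroup ι ℂ) : (Gamma V)ᴴ * Gamma V = 1 := by
  have h := Matrix.mem_unitaryGroup_iff'.mp (Gamma_mem_unitaryGroup hV)
  rwa [star_eq_conjTranspose] at h

/-- `Γ(V) Γ(V)† = 1` for unitary `V`. -/
theorem Gamma_mul_conjTranspose_Gamma {ι : Type*} [LinearOrder ι] [Fintype ι] {V : Matrix ι ι ℂ}
    (hV : V ∈ Matrix.unitaryGroup ι ℂ) : Gamma V * (Gamma V)ᴴ = 1 := by
  have h := Matrix.mem_unitaryGroup_iff.mp (Gamma_mem_unitaryGroup hV)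
  rwa [star_eq_conjTranspose] at h

/-- A Fubini rearrangement with scalar coefficients in a module:
`Σ_x c_x • Σ_y w_{xy} • X_y = Σ_y (Σ_x w_{xy} c_x) • X_y`. -/
theorem sum_smul_sum_smul_comm {α β M : Type*} [Fintype α] [Fintype β] [AddCommMonoid M] [Module ℂ M]
    (c : α → ℂ) (w : α → β → ℂ) (X : β → M) :
    ∑ x, c x • ∑ y, w x y • X y = ∑ y, (∑ x, w x y * c x) • X y := by
  simp only [Finset.smul_sum, smul_smul, Finset.sum_smul]
  rw [Finset.sum_comm]
  refine Finset.sum_congr rfl fun y _ => Finset.sum_congr rfl fun x _ => ?_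
  rw [mul_comm]

end Bookkeeping

/-! ## §1 The RDM pair of the rotated state is the rotated pair -/

section RDMCovariance

variable {ι : Type*} [LinearOrder ι] [Fintype ι]

/-- **`¹D(Γ(Ū)ψ) = U ¹D(ψ) U†`** for unitary `U` and every Fock vector `ψ`: the one-matrix of the
Bogoliubov-rotated state is the congruence-rotated one-matrix of the covariance files
(Bratteli–Robinson II §5.2.1). -/
theorem oneRDM_Gamma_mapStar_mulVec {U : Matrix ι ι ℂ} (hU : U * Uᴴ = 1) (ψ : Fock ι) :
    oneRDM (Gamma (U.map star) *ᵥ ψ) = U * oneRDM ψ * Uᴴ := by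
  ext i k
  rw [oneRDM_Gamma_mulVec (mapStar_mem_unitaryGroup hU), mul_mul_apply, Finset.sum_comm]
  refine Finset.sum_congr rfl fun x _ => Finset.sum_congr rfl fun y _ => ?_
  rw [map_apply, map_apply, star_star, conjTranspose_apply]
  ring

/-- **`²D(Γ(Ū)ψ) = (U ⊗ U) ²D(ψ) (U ⊗ U)†`** for unitary `U` and every Fock vector `ψ`
(Bratteli–Robinson II §5.2.1, four-point content). -/
theorem twoRDM_Gamma_mapStar_mulVec {U : Matrix ι ι ℂ} (hU : U * Uᴴ = 1) (ψ : Fock ι) :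
    twoRDM (Gamma (U.map star) *ᵥ ψ) = U ⊗ₖ U * twoRDM ψ * (U ⊗ₖ U)ᴴ := by
  ext ⟨i, j⟩ ⟨k, l⟩
  rw [twoRDM_Gamma_mulVec (mapStar_mem_unitaryGroup hU), mul_mul_apply]
  calc ∑ m, ∑ n, ∑ p, ∑ q, star ((U.map star) i m) * star ((U.map star) j n) * (U.map star) k p *
          (U.map star) l q * twoRDM ψ (m, n) (p, q)
      = ∑ Y : ι × ι, ∑ X : ι × ι, (U ⊗ₖ U) (i, j) Y * twoRDM ψ Y X * (U ⊗ₖ U)ᴴ X (k, l) := by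
        rw [Fintype.sum_prod_type]
        refine Finset.sum_congr rfl fun m _ => Finset.sum_congr rfl fun n _ => ?_
        rw [Fintype.sum_prod_type]
        refine Finset.sum_congr rfl fun p _ => Finset.sum_congr rfl fun q _ => ?_
        simp only [map_apply, star_star, kroneckerMap_apply, conjTranspose_apply, star_mul']
        ring
    _ = ∑ X : ι × ι, ∑ Y : ι × ι, (U ⊗ₖ U) (i, j) Y * twoRDM ψ Y X * (U ⊗ₖ U)ᴴ X (k, l) :=
        Finset.sum_comm

end RDMCovariance

/-! ## §2 Conjugating the excitation operators by `Γ(Ū)` for a spin-free lift `U` of `u` -/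

section Excitations

variable {Λ : Type*} [LinearOrder Λ] [Fintype Λ]

/-- The smeared creator of the `U`-row of `pσ` is `Σ_a u_{pa} a†_{aσ}` for a spin-free lift. -/
theorem create_orbital {U : Matrix (Orb Λ) (Orb Λ) ℂ} {u : Matrix Λ Λ ℂ}
    (hUu : ∀ p q σ τ, U (orb p σ) (orb q τ) = if σ = τ then u p q else 0) (p : Λ) (σ : Fin 2) :
    create (fun m => U (orb p σ) m) = ∑ a, u p a • creation (orb a σ) := by
  rw [show create (fun m => U (orb p σ) m) = ∑ m, U (orb p σ) m • creation m from rfl,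
    sum_orb_eq_sum_sum]
  refine Finset.sum_congr rfl fun a _ => ?_
  rw [Finset.sum_eq_single σ]
  · rw [hUu, if_pos rfl]
  · intro τ _ hne
    rw [hUu, if_neg (Ne.symm hne), zero_smul]
  · exact fun h => (h (Finset.mem_univ σ)).elim

/-- The smeared annihilator of the `U`-row of `qσ` is `Σ_b ū_{qb} a_{bσ}` for a spin-free lift. -/
theorem annihilate_orbital {U : Matrix (Orb Λ) (Orb Λ) ℂ} {u : Matrix Λ Λ ℂ}
    (hUu : ∀ p q σ τ, U (orb p σ) (orb q τ) = if σ = τ then u p q else 0) (q : Λ) (σ : Fin 2) :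
    annihilate (fun m => U (orb q σ) m) = ∑ b, star (u q b) • annihilation (orb b σ) := by
  rw [show annihilate (fun m => U (orb q σ) m) = ∑ m, star (U (orb q σ) m) • annihilation m from rfl,
    sum_orb_eq_sum_sum]
  refine Finset.sum_congr rfl fun b _ => ?_
  rw [Finset.sum_eq_single σ]
  · rw [hUu, if_pos rfl]
  · intro τ _ hne
    rw [hUu, if_neg (Ne.symm hne), star_zero, zero_smul]
  · exact fun h => (h (Finset.mem_univ σ)).elim

omit [LinearOrder Λ] [Fintype Λ] in
/-- The rows of `Ū = U.map star`, conjugated, are the rows of `U` (the orbitals smeared by `Γ(Ū)†`). -/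
theorem star_mapStar_row (U : Matrix (Orb Λ) (Orb Λ) ℂ) (x : Orb Λ) :
    (fun m => star ((U.map star) x m)) = fun m => U x m := by
  funext m
  rw [map_apply, star_star]

/-- **`Γ(Ū)† E_pq Γ(Ū) = Σ_{ab} u_{pa} ū_{qb} E_ab`**: the singlet excitation operators transform
like the one-electron integrals' dual (Helgaker–Jørgensen–Olsen §3.2; Bratteli–Robinson II §5.2.1
letter by letter). Bundled over `Λ × Λ`. -/
theorem conjTranspose_Gamma_mul_singletExcitation_mul_Gamma {U : Matrix (Orb Λ) (Orb Λ) ℂ}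
    {u : Matrix Λ Λ ℂ} (hU : U * Uᴴ = 1)
    (hUu : ∀ p q σ τ, U (orb p σ) (orb q τ) = if σ = τ then u p q else 0) (p q : Λ) :
    (Gamma (U.map star))ᴴ * singletExcitation p q * Gamma (U.map star) =
      ∑ y : Λ × Λ, (u p y.1 * star (u q y.2)) • singletExcitation y.1 y.2 := by
  have hW := mapStar_mem_unitaryGroup hU
  calc (Gamma (U.map star))ᴴ * singletExcitation p q * Gamma (U.map star)
      = ∑ σ, (Gamma (U.map star))ᴴ * (creation (orb p σ) * annihilation (orb q σ)) *
          Gamma (U.map star) := by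
        rw [singletExcitation, Finset.mul_sum, Finset.sum_mul]
    _ = ∑ σ, create (fun m => U (orb p σ) m) * annihilate (fun m => U (orb q σ) m) := by
        refine Finset.sum_congr rfl fun σ _ => ?_
        rw [conjTranspose_Gamma_mul_excitation_mul_Gamma hW, star_mapStar_row, star_mapStar_row]
    _ = ∑ σ, ∑ a, ∑ b, (u p a * star (u q b)) • (creation (orb a σ) * annihilation (orb b σ)) := by
        refine Finset.sum_congr rfl fun σ _ => ?_
        rw [create_orbital hUu, annihilate_orbital hUu, Finset.sum_mul_sum]
        refine Finset.sum_congr rfl fun a _ => Finset.sum_congr rfl fun b _ => ?_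
        rw [Matrix.smul_mul, Matrix.mul_smul, smul_smul]
    _ = ∑ a, ∑ σ, ∑ b, (u p a * star (u q b)) • (creation (orb a σ) * annihilation (orb b σ)) :=
        Finset.sum_comm
    _ = ∑ a, ∑ b, ∑ σ, (u p a * star (u q b)) • (creation (orb a σ) * annihilation (orb b σ)) :=
        Finset.sum_congr rfl fun _ _ => Finset.sum_comm
    _ = ∑ y : Λ × Λ, (u p y.1 * star (u q y.2)) • singletExcitation y.1 y.2 := by
        rw [Fintype.sum_prod_type]
        refine Finset.sum_congr rfl fun a _ => Finset.sum_congr rfl fun b _ => ?_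
        rw [singletExcitation, Finset.smul_sum]

omit [LinearOrder Λ] in
/-- Expanding a product of four scalar-weighted operator sums, with the summation indices brought
into the order `(a, b, c, d)` and bundled over `κ × κ × κ × κ` (pure algebra). -/
theorem sum_smul_mul_sum_smul_mul_mul {κ : Type*} [Fintype κ] (α β γ δ : κ → ℂ)
    (A B C D : κ → Matrix (Finset (Orb Λ)) (Finset (Orb Λ)) ℂ) :
    (∑ a, α a • A a) * (∑ c, γ c • C c) * (∑ d, δ d • D d) * (∑ b, β b • B b) =
      ∑ y : κ × κ × κ × κ, (α y.1 * β y.2.1 * γ y.2.2.1 * δ y.2.2.2) •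
        (A y.1 * C y.2.2.1 * D y.2.2.2 * B y.2.1) := by
  -- `simp` expands the product with the LAST factor's index outermost: nesting `(b, d, c, a)`
  calc (∑ a, α a • A a) * (∑ c, γ c • C c) * (∑ d, δ d • D d) * (∑ b, β b • B b)
      = ∑ b, ∑ d, ∑ c, ∑ a, (α a * β b * γ c * δ d) • (A a * C c * D d * B b) := by
        simp only [Finset.sum_mul, Finset.mul_sum, Matrix.smul_mul, Matrix.mul_smul, smul_smul]
        refine Finset.sum_congr rfl fun b _ => Finset.sum_congr rfl fun d _ =>
          Finset.sum_congr rfl fun c _ => Finset.sum_congr rfl fun a _ => ?_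
        congr 1
        ring
    _ = ∑ b, ∑ d, ∑ a, ∑ c, (α a * β b * γ c * δ d) • (A a * C c * D d * B b) :=
        Finset.sum_congr rfl fun _ _ => Finset.sum_congr rfl fun _ _ => Finset.sum_comm
    _ = ∑ b, ∑ a, ∑ d, ∑ c, (α a * β b * γ c * δ d) • (A a * C c * D d * B b) :=
        Finset.sum_congr rfl fun _ _ => Finset.sum_comm
    _ = ∑ a, ∑ b, ∑ d, ∑ c, (α a * β b * γ c * δ d) • (A a * C c * D d * B b) := Finset.sum_comm
    _ = ∑ a, ∑ b, ∑ c, ∑ d, (α a * β b * γ c * δ d) • (A a * C c * D d * B b) :=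
        Finset.sum_congr rfl fun _ _ => Finset.sum_congr rfl fun _ _ => Finset.sum_comm
    _ = ∑ y : κ × κ × κ × κ, (α y.1 * β y.2.1 * γ y.2.2.1 * δ y.2.2.2) •
          (A y.1 * C y.2.2.1 * D y.2.2.2 * B y.2.1) := by
        simp only [Fintype.sum_prod_type]

/-- **`Γ(Ū)† e_pqrs Γ(Ū) = Σ_{abcd} u_{pa} ū_{qb} u_{rc} ū_{sd} e_abcd`**: the two-electron
excitation operators transform like the two-electron integrals' dual (Helgaker–Jørgensen–Olsen §3.2;
Bratteli–Robinson II §5.2.1 letter by letter). Bundled over `Λ × Λ × Λ × Λ`. -/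
theorem conjTranspose_Gamma_mul_twoElectronExcitation_mul_Gamma {U : Matrix (Orb Λ) (Orb Λ) ℂ}
    {u : Matrix Λ Λ ℂ} (hU : U * Uᴴ = 1)
    (hUu : ∀ p q σ τ, U (orb p σ) (orb q τ) = if σ = τ then u p q else 0) (p q r s : Λ) :
    (Gamma (U.map star))ᴴ * twoElectronExcitation p q r s * Gamma (U.map star) =
      ∑ y : Λ × Λ × Λ × Λ, (u p y.1 * star (u q y.2.1) * u r y.2.2.1 * star (u s y.2.2.2)) •
        twoElectronExcitation y.1 y.2.1 y.2.2.1 y.2.2.2 := by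
  have hW := mapStar_mem_unitaryGroup hU
  calc (Gamma (U.map star))ᴴ * twoElectronExcitation p q r s * Gamma (U.map star)
      = ∑ σ, ∑ τ, (Gamma (U.map star))ᴴ * (creation (orb p σ) * creation (orb r τ) *
          annihilation (orb s τ) * annihilation (orb q σ)) * Gamma (U.map star) := by
        rw [twoElectronExcitation, Finset.mul_sum, Finset.sum_mul]
        refine Finset.sum_congr rfl fun σ _ => ?_
        rw [Finset.mul_sum, Finset.sum_mul]
    _ = ∑ σ, ∑ τ, create (fun m => U (orb p σ) m) * create (fun m => U (orb r τ) m) *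
          annihilate (fun m => U (orb s τ) m) * annihilate (fun m => U (orb q σ) m) := by
        refine Finset.sum_congr rfl fun σ _ => Finset.sum_congr rfl fun τ _ => ?_
        rw [conjTranspose_Gamma_mul_twoString_mul_Gamma hW, star_mapStar_row, star_mapStar_row,
          star_mapStar_row, star_mapStar_row]
    _ = ∑ σ, ∑ τ, ∑ y : Λ × Λ × Λ × Λ,
          (u p y.1 * star (u q y.2.1) * u r y.2.2.1 * star (u s y.2.2.2)) •
            (creation (orb y.1 σ) * creation (orb y.2.2.1 τ) * annihilation (orb y.2.2.2 τ) *
              annihilation (orb y.2.1 σ)) := by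
        refine Finset.sum_congr rfl fun σ _ => Finset.sum_congr rfl fun τ _ => ?_
        rw [create_orbital hUu, create_orbital hUu, annihilate_orbital hUu, annihilate_orbital hUu,
          sum_smul_mul_sum_smul_mul_mul]
    _ = ∑ x : Fin 2 × Fin 2, ∑ y : Λ × Λ × Λ × Λ,
          (u p y.1 * star (u q y.2.1) * u r y.2.2.1 * star (u s y.2.2.2)) •
            (creation (orb y.1 x.1) * creation (orb y.2.2.1 x.2) * annihilation (orb y.2.2.2 x.2) *
              annihilation (orb y.2.1 x.1)) := by
        simp only [Fintype.sum_prod_type]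
    _ = ∑ y : Λ × Λ × Λ × Λ, ∑ x : Fin 2 × Fin 2,
          (u p y.1 * star (u q y.2.1) * u r y.2.2.1 * star (u s y.2.2.2)) •
            (creation (orb y.1 x.1) * creation (orb y.2.2.1 x.2) * annihilation (orb y.2.2.2 x.2) *
              annihilation (orb y.2.1 x.1)) := Finset.sum_comm
    _ = ∑ y : Λ × Λ × Λ × Λ, (u p y.1 * star (u q y.2.1) * u r y.2.2.1 * star (u s y.2.2.2)) •
          twoElectronExcitation y.1 y.2.1 y.2.2.1 y.2.2.2 := by
        refine Finset.sum_congr rfl fun y _ => ?_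
        rw [twoElectronExcitation, Finset.smul_sum, Fintype.sum_prod_type]
        refine Finset.sum_congr rfl fun σ _ => ?_
        rw [Finset.smul_sum]

end Excitations

/-! ## §3 The operator identity `Γ(Ū)† Ĥ(h, g, h_nuc) Γ(Ū) = Ĥ(h', g', h_nuc)` -/

section Hamiltonian

variable {Λ : Type*} [LinearOrder Λ] [Fintype Λ]

/-- `Ĥ` with its orbital sums bundled over product types (unfolding). -/
theorem molecularHamiltonian_eq_sum_prod (h : Λ → Λ → ℂ) (g : Λ → Λ → Λ → Λ → ℂ) (hnuc : ℂ) :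
    molecularHamiltonian h g hnuc =
      ∑ x : Λ × Λ, h x.1 x.2 • singletExcitation x.1 x.2 +
        (1 / 2 : ℂ) • ∑ x : Λ × Λ × Λ × Λ, g x.1 x.2.1 x.2.2.1 x.2.2.2 •
          twoElectronExcitation x.1 x.2.1 x.2.2.1 x.2.2.2 +
        hnuc • (1 : Matrix (Finset (Orb Λ)) (Finset (Orb Λ)) ℂ) := by
  simp only [molecularHamiltonian, Fintype.sum_prod_type]

/-- The operator identity in bundled form (rotated tables as sums over product types). -/
theorem conjTranspose_Gamma_mul_molecularHamiltonian_mul_Gamma_prod {U : Matrix (Orb Λ) (Orb Λ) ℂ}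
    {u : Matrix Λ Λ ℂ} (hU : U * Uᴴ = 1)
    (hUu : ∀ p q σ τ, U (orb p σ) (orb q τ) = if σ = τ then u p q else 0) (h : Λ → Λ → ℂ)
    (g : Λ → Λ → Λ → Λ → ℂ) (hnuc : ℂ) :
    (Gamma (U.map star))ᴴ * molecularHamiltonian h g hnuc * Gamma (U.map star) =
      molecularHamiltonian (fun a b => ∑ x : Λ × Λ, u x.1 a * star (u x.2 b) * h x.1 x.2)
        (fun a b c d => ∑ x : Λ × Λ × Λ × Λ,
          u x.1 a * star (u x.2.1 b) * u x.2.2.1 c * star (u x.2.2.2 d) * g x.1 x.2.1 x.2.2.1 x.2.2.2)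
        hnuc := by
  have hW := mapStar_mem_unitaryGroup hU
  rw [molecularHamiltonian_eq_sum_prod, molecularHamiltonian_eq_sum_prod, Matrix.mul_add,
    Matrix.mul_add, Matrix.add_mul, Matrix.add_mul]
  congr 1
  congr 1
  · -- one-electron part
    rw [Finset.mul_sum, Finset.sum_mul]
    simp only [Matrix.mul_smul, Matrix.smul_mul,
      conjTranspose_Gamma_mul_singletExcitation_mul_Gamma hU hUu]
    rw [sum_smul_sum_smul_comm]
  · -- two-electron part
    rw [Matrix.mul_smul, Matrix.smul_mul, Finset.mul_sum, Finset.sum_mul]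
    simp only [Matrix.mul_smul, Matrix.smul_mul,
      conjTranspose_Gamma_mul_twoElectronExcitation_mul_Gamma hU hUu]
    rw [sum_smul_sum_smul_comm]
  · -- constant
    rw [Matrix.mul_smul, Matrix.smul_mul, Matrix.mul_one, conjTranspose_Gamma_mul_Gamma hW]

/-- **THE BOGOLIUBOV LIFT CONJUGATES `Ĥ(h, g)` INTO `Ĥ(h', g')`.** For a unitary one-particle matrix
`u` on `Λ` (`U U† = 1` for its spin-free lift `U`, `U_{pσ,qτ} = δ_{στ} u_{pq}`):
`Γ(Ū)† Ĥ(h, g, h_nuc) Γ(Ū) = Ĥ(h', g', h_nuc)` with the ROTATED INTEGRAL TABLES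
`h'_{ab} = Σ_{pq} u_{pa} ū_{qb} h_{pq}`, `g'_{abcd} = Σ_{pqrs} u_{pa} ū_{qb} u_{rc} ū_{sd} g_{pqrs}` of
`rdmEnergy_conj_orbital` — the exact counterpart of the covariance of the energy functional: the model
Hamiltonians of two orthonormal orbital bases of the same one-particle space are unitarily equivalent
on the Fock space (Helgaker–Jørgensen–Olsen §3.2; Bratteli–Robinson II §5.2.1). -/
theorem conjTranspose_Gamma_mul_molecularHamiltonian_mul_Gamma {U : Matrix (Orb Λ) (Orb Λ) ℂ}
    {u : Matrix Λ Λ ℂ} (hU : U * Uᴴ = 1)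
    (hUu : ∀ p q σ τ, U (orb p σ) (orb q τ) = if σ = τ then u p q else 0) (h : Λ → Λ → ℂ)
    (g : Λ → Λ → Λ → Λ → ℂ) (hnuc : ℂ) :
    (Gamma (U.map star))ᴴ * molecularHamiltonian h g hnuc * Gamma (U.map star) =
      molecularHamiltonian (fun a b => ∑ p, ∑ q, u p a * star (u q b) * h p q)
        (fun a b c d => ∑ p, ∑ q, ∑ r, ∑ s, u p a * star (u q b) * u r c * star (u s d) * g p q r s)
        hnuc := by
  rw [conjTranspose_Gamma_mul_molecularHamiltonian_mul_Gamma_prod hU hUu]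
  simp only [Fintype.sum_prod_type]

end Hamiltonian

end Summit.Ventures.CertifiedQuantumChemistry

end
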